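import Literature.Probability.LatticeModels.GlauberLogSobolevScaling
import Literature.Probability.LatticeModels.GlauberLogSobolevBaseScale
import HarnessLib

/-!
# [Mar99] Theorem 4.6: a log-Sobolev constant uniform in all fat rectangles, PROVED

Topic `Literature/Probability/LatticeModels`; cell `ym-ir`, seat lit-3 (census rows B2/B4).  Theorems only
(D-0026).  This file assembles the recursion of [Mar99] (F. Martinelli, *Lectures on Glauber dynamics for
discrete spin models*, LNM 1717, 1999) Theorem 4.6 on fat rectangles from the tree's pieces — the scale step
with rate `fatRectangles_logSobolev_step_rate` (three steps `L → 4L/3 → 16L/9 → 64L/27 ⊇ 2L` give the doubling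
`c_s(2L) ≤ (1 + k/√L) c_s(L)`), the base scale `fatRectangles_logSobolev_at_scale` (Theorem 4.5's uniform gap +
Proposition 3.9), and the convergent product `Π_i (1 + k/√(2^i L₂)) ≤ e^{4k/√L₂}` along the scales `2^i L₂` —
and DISCHARGES the named fact `Glauber.Martinelli1999_thm4_6` (`GlauberDynamicsStrongMixing.lean`):
`theorem Glauber.Martinelli1999_thm4_6_holds`, no new named fact.
* `Glauber.fatRectangles_logSobolev_doubling` — **Theorem 4.6, first part**: `∃ k > 0, ∃ L₁, ∀ L ≥ L₁`,
  `c_s(L)`-bounds on `𝓡_L` give `(1 + k/√L) c_s(L)`-bounds on `𝓡_{2L}`;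
* `Glauber.fatRectangles_uniform_logSobolev` — **Theorem 4.6, second part**: `sup_L c_s(L) < ∞`, i.e. ONE
  log-Sobolev constant for every `μ_R^τ`, `R` a fat rectangle, `τ` arbitrary;
* `Glauber.Martinelli1999_thm4_6_holds`.
SIBLING-SETTING result (`±1` spins, finite range `r`, `d = 2`, hypothesis `SMT` on all fat rectangles): this
is the «strong mixing ⇒ uniform logarithmic Sobolev constant» half of [Mar99]'s Chapter 4 programme; with
Theorem 3.3 it gives exponential ergodicity in `L^∞`.  It says NOTHING about the Yang–Mills mass gap.
[cite: Martinelli1999, Theorem 4.6]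
-/

open MeasureTheory ProbabilityTheory Finset Filter

noncomputable section

namespace Literature.Probability.LatticeModels

namespace Glauber

variable {r : ℕ} (U : FRPotential 2 ℤˣ r) (β : ℝ)

set_option maxHeartbeats 1600000 in
/-- **[Mar99] Theorem 4.6, first part: `c_s(2L) ≤ (1 + k/√L) c_s(L)`** for `L` large (three scale steps of
ratio `4/3`). [cite: Martinelli1999, Theorem 4.6] -/
theorem fatRectangles_logSobolev_doubling {lS : ℕ} {m : ℝ} (hm : 0 < m)
    (hSMT : ∀ L : ℕ, ∀ Q ∈ fatRectangles L, SMT (U.spec β) Q lS m) :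
    ∃ k : ℝ, 0 < k ∧ ∃ L₁ : ℕ, ∀ L : ℕ, L₁ ≤ L → ∀ c : ℝ, 0 ≤ c →
      (∀ R ∈ fatRectangles L, ∀ τ : Site 2 → ℤˣ, LogSobolevIneq (U.spec β R τ) R c) →
        ∀ R ∈ fatRectangles (2 * L), ∀ τ : Site 2 → ℤˣ,
          LogSobolevIneq (U.spec β R τ) R ((1 + k / Real.sqrt L) * c) := by
  obtain ⟨K, hK, L₁, hL₁⟩ := fatRectangles_logSobolev_step_rate U β hm hSMT
  refine ⟨7 * K, by positivity, max (max L₁ 9) ⌈K ^ 2⌉₊, ?_⟩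
  intro L hL c hc hLSI R hR τ
  have hL₁L : L₁ ≤ L := le_trans (le_trans (le_max_left _ _) (le_max_left _ _)) hL
  have hL9 : 9 ≤ L := le_trans (le_trans (le_max_right _ _) (le_max_left _ _)) hL
  have hLK : K ^ 2 ≤ (L : ℝ) := le_trans (Nat.le_ceil _) (by exact_mod_cast le_trans (le_max_right _ _) hL)
  have hLpos : (0 : ℝ) < L := by exact_mod_cast (show 0 < L by omega)
  have hsq : 0 < Real.sqrt L := Real.sqrt_pos.2 hLpos
  set y : ℝ := K / Real.sqrt L with hy
  have hy0 : 0 ≤ y := by positivity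
  have hy1 : y ≤ 1 := by
    rw [hy, div_le_one hsq, Real.le_sqrt hK.le hLpos.le]; exact hLK
  -- the three scales
  set L1 := 4 * L / 3 with hL1
  set L2 := 4 * L1 / 3 with hL2
  set L3 := 4 * L2 / 3 with hL3
  have h01 : L ≤ L1 := by omega
  have h12 : L1 ≤ L2 := by omega
  have h3 : 2 * L ≤ L3 := by omega
  have hs1 : 3 * L1 ≤ 4 * L := by omega
  have hs2 : 3 * L2 ≤ 4 * L1 := by omega
  have hs3 : 3 * L3 ≤ 4 * L2 := by omega
  set u : ℝ := 1 + K / Real.sqrt L with hu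
  have hu0 : 0 ≤ u := by positivity
  have hfac : ∀ L' : ℕ, L ≤ L' → 1 + K / Real.sqrt L' ≤ u := by
    intro L' hLL'
    have h1 : Real.sqrt L ≤ Real.sqrt L' := Real.sqrt_le_sqrt (by exact_mod_cast hLL')
    have h2 : K / Real.sqrt L' ≤ K / Real.sqrt L := div_le_div_of_nonneg_left hK.le hsq h1
    rw [hu]; linarith
  have hfac0 : ∀ L' : ℕ, 0 ≤ 1 + K / Real.sqrt L' := fun L' => by positivity
  -- step 1: `𝓡_L → 𝓡_{L1}`
  have step1 := hL₁ L hL₁L c hc hLSI L1 hs1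
  have hc1 : 0 ≤ (1 + K / Real.sqrt L) * c := mul_nonneg (hfac0 L) hc
  -- step 2: `𝓡_{L1} → 𝓡_{L2}`
  have step2 := hL₁ L1 (le_trans hL₁L h01) _ hc1 step1 L2 hs2
  have hc2 : 0 ≤ (1 + K / Real.sqrt L1) * ((1 + K / Real.sqrt L) * c) := mul_nonneg (hfac0 L1) hc1
  -- step 3: `𝓡_{L2} → 𝓡_{L3} ⊇ 𝓡_{2L}`
  have step3 := hL₁ L2 (le_trans hL₁L (h01.trans h12)) _ hc2 step2 L3 hs3 R (fatRectangles_mono h3 hR) τ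
  refine step3.mono ?_
  have hprod : (1 + K / Real.sqrt L2) * ((1 + K / Real.sqrt L1) * (1 + K / Real.sqrt L)) ≤ u ^ 3 := by
    have e : u ^ 3 = u * (u * u) := by ring
    rw [e]
    exact mul_le_mul (hfac L2 (h01.trans h12)) (mul_le_mul (hfac L1 h01) (hfac L le_rfl) (hfac0 L) hu0)
      (mul_nonneg (hfac0 L1) (hfac0 L)) hu0
  have hcube : u ^ 3 ≤ 1 + 7 * y := by
    have hy2 : y * y ≤ y * 1 := mul_le_mul_of_nonneg_left hy1 hy0
    have hy3 : y * y * y ≤ y * 1 := by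
      calc y * y * y ≤ y * 1 * y := mul_le_mul_of_nonneg_right hy2 hy0
        _ = y * y := by ring
        _ ≤ y * 1 := hy2
    have e : u ^ 3 = 1 + 3 * y + 3 * (y * y) + y * y * y := by rw [hu, hy]; ring
    rw [e]; linarith
  calc (1 + K / Real.sqrt L2) * ((1 + K / Real.sqrt L1) * ((1 + K / Real.sqrt L) * c))
      = (1 + K / Real.sqrt L2) * ((1 + K / Real.sqrt L1) * (1 + K / Real.sqrt L)) * c := by ring
    _ ≤ u ^ 3 * c := mul_le_mul_of_nonneg_right hprod hc
    _ ≤ (1 + 7 * y) * c := mul_le_mul_of_nonneg_right hcube hc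
    _ = (1 + 7 * K / Real.sqrt L) * c := by rw [hy]; ring

set_option maxHeartbeats 1600000 in
/-- **[Mar99] Theorem 4.6, second part: `sup_L c_s(L) < ∞`** — a log-Sobolev constant uniform in all fat
rectangles and boundary conditions (the doubling bound along the scales `2^i L₂`, the product
`Π (1 + k/√(2^i L₂)) ≤ exp(4k/√L₂)`, and the base scale `fatRectangles_logSobolev_at_scale`).
[cite: Martinelli1999, Theorem 4.6] -/
theorem fatRectangles_uniform_logSobolev {lS : ℕ} {m : ℝ} (hm : 0 < m)
    (hSMT : ∀ L : ℕ, ∀ Q ∈ fatRectangles L, SMT (U.spec β) Q lS m) :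
    ∃ c : ℝ, ∀ (L : ℕ), ∀ R ∈ fatRectangles L, ∀ τ : Site 2 → ℤˣ, LogSobolevIneq (U.spec β R τ) R c := by
  classical
  obtain ⟨k, hk, L₁, hL₁⟩ := fatRectangles_logSobolev_doubling U β hm hSMT
  set L₂ : ℕ := max L₁ 1 with hL₂
  have hL₂1 : 1 ≤ L₂ := le_max_right _ _
  have hL₂L₁ : L₁ ≤ L₂ := le_max_left _ _
  have hL₂pos : (0 : ℝ) < L₂ := by exact_mod_cast hL₂1
  obtain ⟨c₀, hc₀, hbase⟩ := fatRectangles_logSobolev_at_scale U β hm hSMT L₂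
  -- the recursion along the scales `2^i L₂`, with the accumulated factor `exp(k T_i)`,
  -- `T_i = Σ_{i'<i} (3/4)^{i'} / √L₂ ≥ Σ_{i'<i} 1/√(2^{i'} L₂)`
  have hrec : ∀ i : ℕ, ∀ R ∈ fatRectangles (2 ^ i * L₂), ∀ τ : Site 2 → ℤˣ,
      LogSobolevIneq (U.spec β R τ) R
        (c₀ * Real.exp (k * ((∑ i' ∈ Finset.range i, (3 / 4 : ℝ) ^ i') / Real.sqrt L₂))) := by
    intro i
    induction i with
    | zero =>
      intro R hR τ
      simp only [Finset.range_zero, Finset.sum_empty, zero_div, mul_zero, Real.exp_zero, mul_one,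
        pow_zero, one_mul] at hR ⊢
      exact hbase R hR τ
    | succ i ih =>
      intro R hR τ
      set c : ℝ := c₀ * Real.exp (k * ((∑ i' ∈ Finset.range i, (3 / 4 : ℝ) ^ i') / Real.sqrt L₂))
        with hc
      have hcpos : 0 ≤ c := by positivity
      have hscale : L₁ ≤ 2 ^ i * L₂ := le_trans hL₂L₁ (Nat.le_mul_of_pos_left L₂ (by positivity))
      have hR' : R ∈ fatRectangles (2 * (2 ^ i * L₂)) := by
        have : 2 ^ (i + 1) * L₂ = 2 * (2 ^ i * L₂) := by ring
        rwa [this] at hR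
      have h := hL₁ (2 ^ i * L₂) hscale c hcpos ih R hR' τ
      refine h.mono ?_
      set x : ℝ := k / Real.sqrt ((2 ^ i * L₂ : ℕ) : ℝ) with hx
      have hsqL : 0 < Real.sqrt ((2 ^ i * L₂ : ℕ) : ℝ) := Real.sqrt_pos.2 (by positivity)
      have hx0 : 0 ≤ x := by positivity
      -- `x ≤ k (3/4)^i / √L₂`
      have hgeom : x ≤ k * ((3 / 4 : ℝ) ^ i / Real.sqrt L₂) := by
        rw [hx, div_eq_mul_one_div k, mul_comm k, mul_comm k]
        refine mul_le_mul_of_nonneg_right ?_ hk.le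
        rw [div_le_div_iff₀ hsqL (Real.sqrt_pos.2 hL₂pos), one_mul]
        have h1 : Real.sqrt ((2 ^ i * L₂ : ℕ) : ℝ) = Real.sqrt ((2 : ℝ) ^ i) * Real.sqrt L₂ := by
          push_cast; exact Real.sqrt_mul (by positivity) _
        rw [h1, ← mul_assoc]
        refine le_mul_of_one_le_left (Real.sqrt_nonneg _) ?_
        have h2 : ((4 : ℝ) / 3) ^ i ≤ Real.sqrt ((2 : ℝ) ^ i) := by
          rw [Real.le_sqrt (by positivity) (by positivity), ← pow_mul, mul_comm, pow_mul]
          exact pow_le_pow_left₀ (by positivity) (by norm_num) i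
        calc (1 : ℝ) = (3 / 4 : ℝ) ^ i * (4 / 3 : ℝ) ^ i := by rw [← mul_pow]; norm_num
          _ ≤ (3 / 4 : ℝ) ^ i * Real.sqrt ((2 : ℝ) ^ i) := mul_le_mul_of_nonneg_left h2 (by positivity)
      have h1 : 1 + x ≤ Real.exp (k * ((3 / 4 : ℝ) ^ i / Real.sqrt L₂)) :=
        (by linarith [Real.add_one_le_exp x] : 1 + x ≤ Real.exp x).trans (Real.exp_le_exp.2 hgeom)
      have hstep : (1 + x) * Real.exp (k * ((∑ i' ∈ Finset.range i, (3 / 4 : ℝ) ^ i') / Real.sqrt L₂)) ≤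
          Real.exp (k * ((∑ i' ∈ Finset.range (i + 1), (3 / 4 : ℝ) ^ i') / Real.sqrt L₂)) := by
        rw [Finset.sum_range_succ, add_div, mul_add, Real.exp_add, mul_comm (1 + x)]
        exact mul_le_mul_of_nonneg_left h1 (Real.exp_pos _).le
      calc (1 + x) * c = c₀ * ((1 + x) *
            Real.exp (k * ((∑ i' ∈ Finset.range i, (3 / 4 : ℝ) ^ i') / Real.sqrt L₂))) := by rw [hc]; ring
        _ ≤ c₀ * Real.exp (k * ((∑ i' ∈ Finset.range (i + 1), (3 / 4 : ℝ) ^ i') / Real.sqrt L₂)) :=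
            mul_le_mul_of_nonneg_left hstep hc₀
  -- the uniform constant
  set cstar : ℝ := c₀ * Real.exp (k * (4 / Real.sqrt L₂)) with hcstar
  refine ⟨cstar, fun L R hR τ => ?_⟩
  have hLi : L ≤ 2 ^ L * L₂ := le_trans (Nat.lt_two_pow_self).le (Nat.le_mul_of_pos_right _ (by omega))
  refine (hrec L R (fatRectangles_mono hLi hR) τ).mono ?_
  rw [hcstar]
  refine mul_le_mul_of_nonneg_left (Real.exp_le_exp.2 ?_) hc₀
  have hsum : (∑ i' ∈ Finset.range L, (3 / 4 : ℝ) ^ i') ≤ 4 := by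
    rw [geom_sum_eq (by norm_num) L]
    have : (0 : ℝ) ≤ (3 / 4 : ℝ) ^ L := by positivity
    have h2 : ((3 / 4 : ℝ) ^ L - 1) / ((3 / 4 : ℝ) - 1) = 4 * (1 - (3 / 4 : ℝ) ^ L) := by
      field_simp; ring
    rw [h2]; nlinarith
  have hsqpos : 0 < Real.sqrt L₂ := Real.sqrt_pos.2 hL₂pos
  have : (∑ i' ∈ Finset.range L, (3 / 4 : ℝ) ^ i') / Real.sqrt L₂ ≤ 4 / Real.sqrt L₂ :=
    div_le_div_of_nonneg_right hsum hsqpos.le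
  exact mul_le_mul_of_nonneg_left this hk.le

/-- **[Mar99] Theorem 4.6 — DISCHARGED**: strong mixing `SMT(R, l, m)` on all fat rectangles implies the
recursive bound `c_s(2L) ≤ (1 + k/√L) c_s(L)` for `L` large and a logarithmic Sobolev constant of the heat-bath
Glauber dynamics bounded uniformly in all fat rectangles and boundary conditions.  Closes the named fact
`Glauber.Martinelli1999_thm4_6` (the binder `U` is the fact's own parameter).
[cite: Martinelli1999, Theorem 4.6] -/
theorem Martinelli1999_thm4_6_holds : Martinelli1999_thm4_6 U := by
  intro β l m hm hSMT
  exact ⟨fatRectangles_logSobolev_doubling U β hm hSMT, fatRectangles_uniform_logSobolev U β hm hSMT⟩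

end Glauber

end Literature.Probability.LatticeModels

end
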